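import Literature.AlgebraicGeometry.Pohlmann1968.HodgeClassesProductSpanCMProductsRank
import HarnessLib

/-!
# Rank additivity descends to slot families: the product-span property and `HC(X) ∧ HC(Y) ⟹ HC(X × Y)` for ALL
# products of copies `⨁_j A_{π j}`, `⨁_j A'_{π' j}`

Family `hodge`, layer `Literature/AlgebraicGeometry/Pohlmann1968`; cell `pub-hodgecm2` (COR-CM), count-neutral own-lane
sequel of `Pohlmann1968/HodgeClassesProductSpanCMProductsRank` (`rank(Σ ⊔ Σ') + 1 = cmFamilyRank Φ + cmFamilyRank Φ'`
⟹ `HodgeClassesProductSpan (⨁ A) (⨁ A')`).  Moonen–Zarhin's (3.1) concerns ALL products `X^k × Y^l`; here the rank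
hypothesis is shown to DESCEND to every pair of slot families `(Φ ∘ π, Φ' ∘ π')`, `π : Fin N → Fin n`,
`π' : Fin N' → Fin m` (products of copies of the `A_i`, resp. `A'_j`, repetitions and omissions allowed):

* `typeRank_sum_add_one_eq_of_preimage` — ABSTRACT: for equivariant maps `σ_i : E_i' → E_i` and the pulled-back types
  `σ_i⁻¹ Σ_i`, additivity of `(Σ₁, Σ₂)` implies additivity of `(σ₁⁻¹Σ₁, σ₂⁻¹Σ₂)` (the antisymmetric spans pull back
  along `f ↦ f ∘ σ_i`, and `U = U₁ × U₂` pulls back to `U' ⊇ U₁' × U₂'`);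
* `typeRank_sum_add_one_eq_slots` — families: additivity for `(Φ, Φ')` ⟹ additivity for `(Φ ∘ π, Φ' ∘ π')`;
* **`hodgeClassesProductSpan_biproduct_slots_of_typeRank_add`** — `HodgeClassesProductSpan (⨁_j A_{π j}) (⨁_j A'_{π' j})`;
  `hodgeConjectureFor_prod_slots_of_typeRank_add` — `HC(⨁_j A_{π j}) ∧ HC(⨁_j A'_{π' j}) ⟹ HC(product)`.

So: `Hg(X × Y) = Hg(X) × Hg(Y)` ⟹ the Hodge classes of every `X^k × Y^l` (indeed of every `∏ A_i^{k_i} × ∏ A'_j^{l_j}`)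
are generated by those of the factors — the direction ⟸ of Moonen–Zarhin's equivalence in full.  Theorems only; no
definition, no named fact; axioms `propext`, `Classical.choice`, `Quot.sound`.

## References
* [MoonenZarhin1999LowDim] B. Moonen, Yu. Zarhin, Math. Ann. 315 (1999) 711–733, §3 (3.1).
* [Gordon1999HodgeAVSurvey] B. B. Gordon, *A survey of the Hodge conjecture for abelian varieties*, 7.5–7.7, 9.1.
-/

noncomputable section

open CategoryTheory CategoryTheory.Limits NumberField

namespace Literature.AlgebraicGeometry.Pohlmann1968

open Module
open Literature.AlgebraicGeometry.Motives (AbelianVariety CMType)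
open Literature.AlgebraicGeometry.HodgeTheory
open Literature.AlgebraicGeometry.ComplexMultiplication (IsCMTypeRealisation)
open Literature.NumberTheory.ComplexMultiplication

/-! ### §1 Additivity pulls back along equivariant maps of the index sets -/

section Abstract

variable {G : Type*} [Group G] {E₁ E₂ E₁' E₂' : Type*} [MulAction G E₁] [MulAction G E₂] [MulAction G E₁']
  [MulAction G E₂'] [Fintype E₁] [Fintype E₂] [Fintype E₁'] [Fintype E₂']

/-- The indicator of a translate of a pulled-back type `Σ' = σ⁻¹Σ` is the indicator of the translate of `Σ`
composed with `σ` (equivariance). [folklore] -/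
private theorem translateInd_pre_apply {E E' : Type*} [MulAction G E] [MulAction G E'] {σ : E' → E}
    (hσ : ∀ (g : G) (z : E'), σ (g • z) = g • σ z) {Ψ : Set E} {Ψ' : Set E'} (hpre : ∀ z, z ∈ Ψ' ↔ σ z ∈ Ψ)
    (g : G) (z : E') : translateInd Ψ' g z = translateInd Ψ g (σ z) := by
  by_cases h : g • σ z ∈ Ψ
  · rw [translateInd_of_mem h, translateInd_of_mem ((hpre _).2 (by rw [hσ]; exact h))]
  · rw [translateInd_of_not_mem h, translateInd_of_not_mem fun h' => h (by rw [← hσ]; exact (hpre _).1 h')]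

/-- `u_g(Σ') = u_g(Σ) ∘ σ`. [folklore] -/
private theorem antiVec_pre {E E' : Type*} [MulAction G E] [MulAction G E'] {σ : E' → E}
    (hσ : ∀ (g : G) (z : E'), σ (g • z) = g • σ z) {Ψ : Set E} {Ψ' : Set E'} (hpre : ∀ z, z ∈ Ψ' ↔ σ z ∈ Ψ)
    (g : G) : antiVec Ψ' g = LinearMap.funLeft ℚ ℚ σ (antiVec Ψ g) := by
  funext z
  rw [LinearMap.funLeft_apply]
  show 2 * translateInd Ψ' g z - 1 = 2 * translateInd Ψ g (σ z) - 1
  rw [translateInd_pre_apply hσ hpre]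

/-- `U(Σ')` is the pull-back of `U(Σ)` along `f ↦ f ∘ σ`. [folklore] -/
private theorem antiSpan_pre {E E' : Type*} [MulAction G E] [MulAction G E'] {σ : E' → E}
    (hσ : ∀ (g : G) (z : E'), σ (g • z) = g • σ z) {Ψ : Set E} {Ψ' : Set E'} (hpre : ∀ z, z ∈ Ψ' ↔ σ z ∈ Ψ) :
    antiSpan G Ψ' = (antiSpan G Ψ).map (LinearMap.funLeft ℚ ℚ σ) := by
  rw [antiSpan, antiSpan, Submodule.map_span, ← Set.range_comp]
  exact congrArg (fun f : G → (E' → ℚ) => Submodule.span ℚ (Set.range f)) (funext fun g => antiVec_pre hσ hpre g)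

/-- `dim (p × q) = dim p + dim q`. [folklore] -/
private theorem finrank_prod_eq₄ (p : Submodule ℚ (E₁' → ℚ)) (q : Submodule ℚ (E₂' → ℚ)) :
    Module.finrank ℚ (p.prod q) = Module.finrank ℚ p + Module.finrank ℚ q := by
  have hinj : Function.Injective (p.subtype.prodMap q.subtype) := by
    rintro ⟨a, b⟩ ⟨a', b'⟩ h
    simp only [LinearMap.prodMap_apply, Submodule.subtype_apply, Prod.mk.injEq] at h
    exact Prod.ext (Subtype.ext h.1) (Subtype.ext h.2)
  have hrange : LinearMap.range (p.subtype.prodMap q.subtype) = p.prod q := by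
    rw [LinearMap.range_prodMap, Submodule.range_subtype, Submodule.range_subtype]
  rw [← hrange, LinearMap.finrank_range_of_inj hinj, Module.finrank_prod]

/-- **Rank additivity descends along equivariant maps.**  Let `σ₁ : E₁' → E₁`, `σ₂ : E₂' → E₂` be `G`-equivariant and
`Σ_i' = σ_i⁻¹ Σ_i` pulled-back CM types (e.g. the types of products of COPIES of CM abelian varieties, `σ` the slot
projection).  If `rank(Σ₁ ⊔ Σ₂) + 1 = rank Σ₁ + rank Σ₂` then `rank(Σ₁' ⊔ Σ₂') + 1 = rank Σ₁' + rank Σ₂'`: the spans of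
pairs and the antisymmetric spans pull back along `(f₁, f₂) ↦ (f₁ ∘ σ₁, f₂ ∘ σ₂)`, so `U(Σ₁ ⊔ Σ₂) = U(Σ₁) × U(Σ₂)`
(`span_pair_antiVec_eq_prod_of_typeRank_eq`) gives `U(Σ₁') × U(Σ₂') ≤ U(Σ₁' ⊔ Σ₂')` (`Hg(X^k × Y^l) = Hg(X^k) × Hg(Y^l)`
from `Hg(X × Y) = Hg(X) × Hg(Y)`). [cite: MoonenZarhin1999LowDim, §3 (3.1)] -/
theorem typeRank_sum_add_one_eq_of_preimage [Nonempty E₁] [Nonempty E₂] [Nonempty E₁'] [Nonempty E₂'] {ρ : G}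
    {Φ₁ : Set E₁} {Φ₂ : Set E₂} {Φ₁' : Set E₁'} {Φ₂' : Set E₂'} (h₁ : IsCMTypeWith ρ Φ₁) (h₂ : IsCMTypeWith ρ Φ₂)
    (h₁' : IsCMTypeWith ρ Φ₁') (h₂' : IsCMTypeWith ρ Φ₂') {σ₁ : E₁' → E₁} {σ₂ : E₂' → E₂}
    (hσ₁ : ∀ (g : G) (z : E₁'), σ₁ (g • z) = g • σ₁ z) (hσ₂ : ∀ (g : G) (z : E₂'), σ₂ (g • z) = g • σ₂ z)
    (hpre₁ : ∀ z, z ∈ Φ₁' ↔ σ₁ z ∈ Φ₁) (hpre₂ : ∀ z, z ∈ Φ₂' ↔ σ₂ z ∈ Φ₂)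
    (hrank : typeRank G {z : E₁ ⊕ E₂ | Sum.elim (· ∈ Φ₁) (· ∈ Φ₂) z} + 1 = typeRank G Φ₁ + typeRank G Φ₂) :
    typeRank G {z : E₁' ⊕ E₂' | Sum.elim (· ∈ Φ₁') (· ∈ Φ₂') z} + 1 = typeRank G Φ₁' + typeRank G Φ₂' := by
  -- the spans of pairs, base and pulled back
  set W := Submodule.span ℚ (Set.range fun g : G => (antiVec Φ₁ g, antiVec Φ₂ g)) with hW
  set W' := Submodule.span ℚ (Set.range fun g : G => (antiVec Φ₁' g, antiVec Φ₂' g)) with hW'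
  have hWW' : W' = W.map ((LinearMap.funLeft ℚ ℚ σ₁).prodMap (LinearMap.funLeft ℚ ℚ σ₂)) := by
    rw [hW, Submodule.map_span, ← Set.range_comp, hW']
    exact congrArg (fun f : G → (E₁' → ℚ) × (E₂' → ℚ) => Submodule.span ℚ (Set.range f))
      (funext fun g => Prod.ext (antiVec_pre hσ₁ hpre₁ g) (antiVec_pre hσ₂ hpre₂ g))
  have hWP : W = (antiSpan G Φ₁).prod (antiSpan G Φ₂) := span_pair_antiVec_eq_prod_of_typeRank_eq h₁ h₂ hrank
  -- `U(Σ₁') × U(Σ₂') ≤ W'`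
  have hle : (antiSpan G Φ₁').prod (antiSpan G Φ₂') ≤ W' := by
    rintro ⟨x', y'⟩ ⟨hx', hy'⟩
    obtain ⟨x, hx, hxe⟩ := Submodule.mem_map.1
      (show x' ∈ (antiSpan G Φ₁).map (LinearMap.funLeft ℚ ℚ σ₁) by rw [← antiSpan_pre hσ₁ hpre₁]; exact hx')
    obtain ⟨y, hy, hye⟩ := Submodule.mem_map.1
      (show y' ∈ (antiSpan G Φ₂).map (LinearMap.funLeft ℚ ℚ σ₂) by rw [← antiSpan_pre hσ₂ hpre₂]; exact hy')
    have hxy : (x, y) ∈ W := by rw [hWP]; exact ⟨hx, hy⟩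
    rw [hWW']
    exact Submodule.mem_map.2 ⟨(x, y), hxy, Prod.ext hxe hye⟩
  -- dimension count
  refine le_antisymm (typeRank_sum_add_one_le h₁' h₂') ?_
  rw [(h₁'.sum h₂').typeRank_eq_finrank_antiSpan_add_one, h₁'.typeRank_eq_finrank_antiSpan_add_one,
    h₂'.typeRank_eq_finrank_antiSpan_add_one]
  have h := Submodule.finrank_mono hle
  rw [finrank_prod_eq₄, hW', ← map_antiSpan_sum_eq_span, LinearEquiv.finrank_map_eq] at h
  omega

end Abstract

/-! ### §2 Slot families: products of copies of the `A_i`, `A'_j` -/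

section Slots

variable {n m : ℕ} {K : Fin n → Type} {K' : Fin m → Type}
  [∀ i, Field (K i)] [∀ i, NumberField (K i)] [∀ j, Field (K' j)] [∀ j, NumberField (K' j)]
  [∀ i, IsCMField (K i)] [∀ j, IsCMField (K' j)]

/-- **Rank additivity descends to slot families.**  If `rank(Σ ⊔ Σ') + 1 = cmFamilyRank Φ + cmFamilyRank Φ'`, then the
same holds for the families `(Φ (π j))_j`, `(Φ' (π' j))_j` of the products of copies `⨁_j A_{π j}`, `⨁_j A'_{π' j}`, for
all slot maps `π : Fin N → Fin n`, `π' : Fin N' → Fin m` (`N, N' ≠ 0`): the slot projections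
`(j, s) ↦ (π j, s)` are `Aut(ℂ)`-equivariant and pull the family types back (`typeRank_sum_add_one_eq_of_preimage`) —
`Hg(X^k × Y^l) = Hg(X^k) × Hg(Y^l)` follows from `Hg(X × Y) = Hg(X) × Hg(Y)`. [cite: MoonenZarhin1999LowDim, §3 (3.1)] -/
theorem typeRank_sum_add_one_eq_slots [NeZero n] [NeZero m] {N N' : ℕ} [NeZero N] [NeZero N']
    (Φ : ∀ i, CMType (K i)) (Φ' : ∀ j, CMType (K' j))
    (hrank : typeRank (ℂ ≃+* ℂ) {z : (Σ i, (K i →+* ℂ)) ⊕ (Σ j, (K' j →+* ℂ)) |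
        Sum.elim (· ∈ CMAlgebra.familyType Φ) (· ∈ CMAlgebra.familyType Φ') z} + 1 =
      CMAlgebra.cmFamilyRank Φ + CMAlgebra.cmFamilyRank Φ')
    (π : Fin N → Fin n) (π' : Fin N' → Fin m) :
    typeRank (ℂ ≃+* ℂ) {z : (Σ j, (K (π j) →+* ℂ)) ⊕ (Σ j, (K' (π' j) →+* ℂ)) |
        Sum.elim (· ∈ CMAlgebra.familyType (fun j => Φ (π j))) (· ∈ CMAlgebra.familyType (fun j => Φ' (π' j))) z} + 1 =
      CMAlgebra.cmFamilyRank (fun j => Φ (π j)) + CMAlgebra.cmFamilyRank (fun j => Φ' (π' j)) := by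
  haveI : Nonempty (Σ i, (K i →+* ℂ)) := by
    obtain ⟨s⟩ := (inferInstance : Nonempty (K 0 →+* ℂ)); exact ⟨⟨0, s⟩⟩
  haveI : Nonempty (Σ j, (K' j →+* ℂ)) := by
    obtain ⟨t⟩ := (inferInstance : Nonempty (K' 0 →+* ℂ)); exact ⟨⟨0, t⟩⟩
  haveI : Nonempty (Σ j, (K (π j) →+* ℂ)) := by
    obtain ⟨s⟩ := (inferInstance : Nonempty (K (π 0) →+* ℂ)); exact ⟨⟨0, s⟩⟩
  haveI : Nonempty (Σ j, (K' (π' j) →+* ℂ)) := by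
    obtain ⟨t⟩ := (inferInstance : Nonempty (K' (π' 0) →+* ℂ)); exact ⟨⟨0, t⟩⟩
  exact typeRank_sum_add_one_eq_of_preimage (CMAlgebra.isCMTypeWith_familyType Φ)
    (CMAlgebra.isCMTypeWith_familyType Φ') (CMAlgebra.isCMTypeWith_familyType fun j => Φ (π j))
    (CMAlgebra.isCMTypeWith_familyType fun j => Φ' (π' j)) (σ₁ := CMAlgebra.slotProj π) (σ₂ := CMAlgebra.slotProj π')
    (fun τ z => by obtain ⟨j, s⟩ := z; rfl) (fun τ z => by obtain ⟨j, t⟩ := z; rfl) (fun _ => Iff.rfl)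
    (fun _ => Iff.rfl) hrank

variable {Φ : ∀ i, CMType (K i)} {Φ' : ∀ j, CMType (K' j)}
  {A : Fin n → AbelianVariety ℂ} {A' : Fin m → AbelianVariety ℂ}
  {ι : ∀ i, 𝓞 (K i) →+* End (A i)} {ι' : ∀ j, 𝓞 (K' j) →+* End (A' j)}
  {θ : ∀ i, K i →+* Module.End ℂ (complexBetti (A i).X 1)}
  {θ' : ∀ j, K' j →+* Module.End ℂ (complexBetti (A' j).X 1)}

/-- **Moonen–Zarhin (3.1) ⟸ for CM products, ALL products of copies**: under rank additivity for `(Φ, Φ')`, for every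
pair of slot maps `π : Fin N → Fin n`, `π' : Fin N' → Fin m` (`N, N' ≠ 0`) the Hodge classes of
`(⨁_j A_{π j}) × (⨁_j A'_{π' j})` — e.g. of `X^k × Y^l`, or of `∏ A_i^{k_i} × ∏ A'_j^{l_j}` — are spanned by exterior
products of Hodge classes of the two factors. [cite: MoonenZarhin1999LowDim, §3 (3.1)] -/
theorem hodgeClassesProductSpan_biproduct_slots_of_typeRank_add [NeZero n] [NeZero m] {N N' : ℕ} [NeZero N]
    [NeZero N'] (hA : ∀ i, IsCMTypeRealisation (Φ i) (A i) (ι i) (θ i))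
    (hA' : ∀ j, IsCMTypeRealisation (Φ' j) (A' j) (ι' j) (θ' j))
    (hrank : typeRank (ℂ ≃+* ℂ) {z : (Σ i, (K i →+* ℂ)) ⊕ (Σ j, (K' j →+* ℂ)) |
        Sum.elim (· ∈ CMAlgebra.familyType Φ) (· ∈ CMAlgebra.familyType Φ') z} + 1 =
      CMAlgebra.cmFamilyRank Φ + CMAlgebra.cmFamilyRank Φ')
    (π : Fin N → Fin n) (π' : Fin N' → Fin m) :
    HodgeClassesProductSpan (⨁ fun j => A (π j)) (⨁ fun j => A' (π' j)) :=
  hodgeClassesProductSpan_biproduct_of_typeRank_add (K := fun j => K (π j)) (K' := fun j => K' (π' j))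
    (fun j => hA (π j)) (fun j => hA' (π' j)) (typeRank_sum_add_one_eq_slots Φ Φ' hrank π π')

/-- **Isogenous factors, all products of copies**: `X ~ ⨁_j A_{π j}`, `Y ~ ⨁_j A'_{π' j}` (e.g. `X ~ X₀^k`, `Y ~ Y₀^l`)
⟹ `HodgeClassesProductSpan X Y`, under rank additivity for `(Φ, Φ')`. [cite: MoonenZarhin1999LowDim, §3 (3.1)]
[cite: vanGeemen1994HodgeAV, §3.6 (p. 236)] -/
theorem hodgeClassesProductSpan_of_isIsogenous_biproduct_slots_of_typeRank_add [NeZero n] [NeZero m] {N N' : ℕ}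
    [NeZero N] [NeZero N'] (hA : ∀ i, IsCMTypeRealisation (Φ i) (A i) (ι i) (θ i))
    (hA' : ∀ j, IsCMTypeRealisation (Φ' j) (A' j) (ι' j) (θ' j))
    (hrank : typeRank (ℂ ≃+* ℂ) {z : (Σ i, (K i →+* ℂ)) ⊕ (Σ j, (K' j →+* ℂ)) |
        Sum.elim (· ∈ CMAlgebra.familyType Φ) (· ∈ CMAlgebra.familyType Φ') z} + 1 =
      CMAlgebra.cmFamilyRank Φ + CMAlgebra.cmFamilyRank Φ')
    (π : Fin N → Fin n) (π' : Fin N' → Fin m) {X Y : AbelianVariety ℂ}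
    (hXi : AbelianVariety.IsIsogenous X (⨁ fun j => A (π j)))
    (hYi : AbelianVariety.IsIsogenous Y (⨁ fun j => A' (π' j))) : HodgeClassesProductSpan X Y :=
  (hodgeClassesProductSpan_biproduct_slots_of_typeRank_add hA hA' hrank π π').of_isIsogenous hXi hYi

/-- **`HC(⨁_j A_{π j}) ∧ HC(⨁_j A'_{π' j}) ⟹ HC` of the product (and of its isogenous copies)**, for all slot maps, under
rank additivity for `(Φ, Φ')` — the Hodge conjecture is multiplicative across ALL products of copies of two
rank-additive CM families. [cite: MoonenZarhin1999LowDim, §3 (3.1)] [cite: vanGeemen1994HodgeAV, §3.5–3.7 Lemma 3.7 (p. 236)] -/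
theorem hodgeConjectureFor_prod_slots_of_typeRank_add [NeZero n] [NeZero m] {N N' : ℕ} [NeZero N] [NeZero N']
    (hA : ∀ i, IsCMTypeRealisation (Φ i) (A i) (ι i) (θ i))
    (hA' : ∀ j, IsCMTypeRealisation (Φ' j) (A' j) (ι' j) (θ' j))
    (hrank : typeRank (ℂ ≃+* ℂ) {z : (Σ i, (K i →+* ℂ)) ⊕ (Σ j, (K' j →+* ℂ)) |
        Sum.elim (· ∈ CMAlgebra.familyType Φ) (· ∈ CMAlgebra.familyType Φ') z} + 1 =
      CMAlgebra.cmFamilyRank Φ + CMAlgebra.cmFamilyRank Φ')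
    (π : Fin N → Fin n) (π' : Fin N' → Fin m) {X Y : AbelianVariety ℂ}
    (hXi : AbelianVariety.IsIsogenous X (⨁ fun j => A (π j)))
    (hYi : AbelianVariety.IsIsogenous Y (⨁ fun j => A' (π' j))) (hHX : HodgeConjectureFor X.dim X.X)
    (hHY : HodgeConjectureFor Y.dim Y.X) : HodgeConjectureFor (X.prod Y).dim (X.prod Y).X :=
  hodgeConjectureFor_prod_of_productSpan X Y
    (hodgeClassesProductSpan_of_isIsogenous_biproduct_slots_of_typeRank_add hA hA' hrank π π' hXi hYi) hHX hHY

end Slots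

end Literature.AlgebraicGeometry.Pohlmann1968

end
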